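import Summits.ValiantsHypothesis.ValiantsHypothesis.Theses.RigidityForcesSymmetry
import Summits.ValiantsHypothesis.ValiantsHypothesis.Theorems.RigidityForcesSymmetryGrenetFirstOrderRankRigidPencil
import Summits.ValiantsHypothesis.ValiantsHypothesis.Theorems.RigidityForcesSymmetryGrenetFirstOrderRankRigidConstGauge
import Summits.ValiantsHypothesis.ValiantsHypothesis.Theorems.RigidityForcesSymmetryGrenetFirstOrderRankRigidBorders
import Summits.ValiantsHypothesis.ValiantsHypothesis.Theorems.RigidityForcesSymmetryGrenetFirstOrderRankRigidBlockIIPQ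

/-!
# Route RigidityForcesSymmetry — `GrenetFirstOrderRankRigid` (item stmt-ValiantsHypothesis-21029): the crux

Crux line `Cruxes/GrenetFirstOrderRankRigid/Lines/grenet_gauge.lean` (val-width-21029-p1/p2/p3), now sorry-free.
GRENET FIRST-ORDER RANK RIGIDITY for all `n ≥ 3`: Grenet's `(2ⁿ - 1) × (2ⁿ - 1)` affine pencil
`Λ + Σ_v x_v A_v` of `per_n` (tree `Grenet.repr`, any vertex enumeration) has `det = per_n`, and every first-order
deformation `(Λ', A')` that is Zariski-tangent to `{det = per_n}` (`tr(adj(x̃)·x̃') = 0`) and tangent to the rank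
strata of the coefficient matrices (`A'_v (ker A_v) ⊆ im A_v`) is a gauge direction `(PΛ - ΛQ, PA_v - A_vQ)`.
Assembly (every step a theorem of `Theorems/RigidityForcesSymmetryGrenetFirstOrderRankRigid*.lean`): the pencil
(`grenet_pencil_eq`), the degree-zero part / trace-balanced constant gauge (`grenet_constGauge`), and linear
rigidity `grenet_linearRigid_of_blockII_PQ` (reduction to homogeneous directions, allowed entries, path form of the
adjugate, torus-weight blocks W0, III/I<, I=, I>, the type-II borders, gluing) fed with the last block identity
`grenet_blockII_PQ` ((D-PQ) for the overlap blocks of type II: permutation designs with one extra cell and the block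
algebra in characteristic zero).  Certified numerically beforehand for `n = 3..8` (kit j025573).
Honest label: this settles the T2 rung `GrenetFirstOrderRankRigid` (crux of the route `RigidityForcesSymmetry`);
it calibrates, but does not prove, `RankRigidMinimalRepr` / `GrenetLowerBound`; VP ≠ VNP is not moved by this file.
-/

noncomputable section

open MvPolynomial Matrix Finset

namespace Summit.ValiantsHypothesis.Theorems.RigidityForcesSymmetry.GrenetGauge

open Literature.Computability.AlgebraicComplexity

/-- **Grenet first-order rank rigidity** (crux `GrenetFirstOrderRankRigid` of the route `RigidityForcesSymmetry`,
item stmt-ValiantsHypothesis-21029): for every `n ≥ 3`, Grenet's pencil represents `per_n` and every rank-constrained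
Zariski-tangent direction at it is a gauge direction. [cite: Grenet2011, Thm. 1] -/
theorem GrenetFirstOrderRankRigid_proof :
    Summit.ValiantsHypothesis.ValiantsHypothesis.Theses.RigidityForcesSymmetry.GrenetFirstOrderRankRigid := by
  intro n hn
  have hN : 2 ^ n = 2 ^ n - 1 + 1 := by
    have := Nat.one_le_two_pow (n := n)
    omega
  have hcard : Fintype.card (Finset (Fin n)) = 2 ^ n - 1 + 1 := by
    rw [Fintype.card_finset, Fintype.card_fin]; omega
  obtain ⟨E⟩ : Nonempty (Finset (Fin n) ≃ Fin (2 ^ n - 1 + 1)) := ⟨Fintype.equivFinOfCardEq hcard⟩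
  have hp := grenet_pencil_eq (k := ℂ) n (by omega) hN E
  refine ⟨fun i j => coeff 0 (Grenet.repr ℂ n E i j),
    fun v i j => coeff (Finsupp.single v 1) (Grenet.repr ℂ n E i j), ?_, ?_⟩
  · show (Matrix.map (fun i j => coeff 0 (Grenet.repr ℂ n E i j) : Matrix _ _ ℂ) C
        + ∑ v, (X v : MvPolynomial (Fin n × Fin n) ℂ) •
          Matrix.map (fun i j => coeff (Finsupp.single v 1) (Grenet.repr ℂ n E i j) : Matrix _ _ ℂ) C).det = _
    rw [hp]
    exact (Grenet.isAffineDetRepr_repr ℂ n (by omega) hN E).2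
  · intro Λ' A' htr hC
    exact grenet_linearRigid_of_blockII_PQ E (by omega) hN (grenet_blockII_PQ E (by omega) hN) Λ' A' htr hC
      (grenet_constGauge E (by omega) (fun _ _ => rfl) _ Λ' A' htr)

end Summit.ValiantsHypothesis.Theorems.RigidityForcesSymmetry.GrenetGauge
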